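import Summits.HodgeConjecture.CorCM.MultiFieldWeilPrimes
import Mathlib.GroupTheory.GroupAction.Primitive
import HarnessLib

/-!
# MULTI-FIELD WEIL ENGINE — EQUAL PRIMES: CM fields of the SAME prime relative degree over `k` enter the prime tower under an ORDER, each field being moved by an
# automorphism of `ℂ` that fixes its equal-degree predecessors (e.g. two fields of the same prime relative degree with different Galois closures) — the
# defect law and the Hodge conjecture for every product of copies GIVEN the single-slot Weil spaces

Cell `pub-hodgecm2` (COR-CM), seat b30 gen 30 (2026-08-24); count-neutral own lane MULTI-FIELD WEIL ENGINE (stem `MultiFieldWeil*`), sequel of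
`CorCM/MultiFieldWeilPrimeTower.lean` (`const_of_signed_primeTower`, stated for PRIORITIES) and `CorCM/MultiFieldWeilPrimes.lean`.  Theorems only; no definition, no
named fact, no `sorry`, no `decide`.  HONEST FRAMING: conditional on the displayed single-slot Weil spaces `hW m` exactly as in `CorCM/MultiFieldWeilPrimes.lean`;
`HC_CM` is NOT proved and not asserted.

THE POINT.  The prime tower of `MultiFieldWeilPrimeTower` peels slots of pairwise DISTINCT prime sizes because a realised tuple of order `ℓ` at a slot has a power
that is the identity on every SMALLER slot.  Two slots of the SAME prime size `ℓ` (two non-isomorphic CM fields `K₁`, `K₂` of relative degree `ℓ` over `k`) cannot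
be separated by powers.  The separation is Galois-theoretic instead: (§1) inside the slot image `G ≤ Sym(ℓ)` of the realised tuples — transitive of PRIME degree,
hence PRIMITIVE — the image of the tuples that are the identity on a set `S` of other slots is a NORMAL subgroup, so it is transitive as soon as it is non-trivial
(Wielandt; Mathlibʼs `IsPreprimitive.isQuasiPreprimitive`), and then Cauchy gives such a tuple of order `ℓ` at the slot (**`exists_orderOf_eq_of_trivial_on`**);
(§2) a tuple trivial on `S` and non-trivial at the slot is realised by any automorphism of `ℂ` over `k` fixing the `τ`-embeddings of the fields of `S` and moving
one of the slotʼs (**`exists_trivial_on_ne_one_mem_realisedTuples`**); combined with the power trick for the smaller slots this is the `hpure` input of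
`const_of_signed_primeTower` for a priority order refining the sizes (**`pure_realisedTuples_orderedPrimeTower`**).  Hence (§3) THE DEFECT LAW and (§4) the
HEADLINE **`hodgeConjectureFor_biproduct_comp_of_orderedPrimeTower_oneMember`** (+ intrinsic form, + dominated): one-member slots of pairwise coprime sizes below a
tower of PRIME sizes (repetitions allowed) carrying ANY types, ordered by a priority refining the sizes, such that each tower slot is MOVED by an automorphism of
`ℂ` over `τ(k)` FIXING every `τ`-embedding of its equal-size predecessors — GIVEN the single-slot Weil spaces.  For two fields of the same prime relative degree the
hypothesis on the later one says: some conjugate of it is not contained in the Galois closure of the earlier one over `k`; it fails exactly when the two fields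
have the same Galois closure (e.g. the two inequivalent degree-`7` actions of `PSL₂(𝔽₇)`, the degree-`11` twins of `PSL₂(𝔽₁₁)`), where the joint image is a graph
and the census is genuinely different.
[cite: DixonMortimer1996, §1.6 and Thm. 1.6A] [cite: MoonenZarhin1995Duke, Thm. 2.4] [cite: Shimura1998, §18.2 Lemma (i)] [cite: Pohlmann1968, Thm 1]
[cite: Milne2020HodgeClassesAV, 1.2 (a) and Thm. 1] [cite: MumfordAV1970, §19]

## References
* [DixonMortimer1996] J. D. Dixon, B. Mortimer, *Permutation Groups*, GTM 163, §1.6, Thm. 1.6A (normal subgroups of primitive groups are transitive).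
  [MoonenZarhin1995Duke] B. Moonen, Yu. Zarhin, Duke Math. J. 77 (1995), Thm. 2.4.  [Shimura1998] G. Shimura, *Abelian varieties with CM and modular functions*,
  §18.2 Lemma (i).  [Pohlmann1968] H. Pohlmann, Ann. of Math. 88 (1968), Thm 1.  [Milne2020HodgeClassesAV] J. S. Milne, arXiv:2010.08857, 1.2 (a), Thm. 1.
  [MumfordAV1970] D. Mumford, *Abelian Varieties*, §19.
-/

noncomputable section

open CategoryTheory CategoryTheory.Limits NumberField

namespace Summit.HodgeConjecture.CorCM.MultiFieldWeil

open Finset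
open Literature.AlgebraicGeometry Literature.AlgebraicGeometry.Motives Literature.AlgebraicGeometry.HodgeTheory
open Literature.AlgebraicGeometry.ComplexMultiplication (IsCMTypeRealisation)
open Literature.AlgebraicTopology.SingularHomology
open Literature.NumberTheory.ComplexMultiplication
open Summit.HodgeConjecture.CorCM.Census.MultiFieldWeil

open scoped Classical

/-! ## §1 Tuples trivial on a set of slots: a normal subgroup of a primitive slot image -/

section Group

variable {r : ℕ} {n : Fin r → ℕ} {R : Finset (PermsG n)}

/-- **TUPLES TRIVIAL ON `S` AND NON-TRIVIAL AT A PRIME SLOT CONTAIN ONE OF ORDER `ℓ` THERE.**  `R ⊆ ∏_m Sym(n_m)` product-closed, inverse-closed, non-empty and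
transitive on the slot `m₀` of PRIME size `ℓ = n m₀`; if some tuple of `R` is the identity on every slot of `S` but not at `m₀`, then some tuple of `R` is the
identity on `S` with `m₀`-component of order `ℓ`: the `m₀`-image of the tuples trivial on `S` is a normal subgroup of the (primitive) slot image, non-trivial
hence transitive (Wielandt), so `ℓ` divides its order and Cauchy applies. [cite: DixonMortimer1996, §1.6 and Thm. 1.6A] -/
theorem exists_orderOf_eq_of_trivial_on (hmul : ∀ π ∈ R, ∀ π' ∈ R, π * π' ∈ R) (hinv : ∀ π ∈ R, π⁻¹ ∈ R) (hne : R.Nonempty)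
    {m₀ : Fin r} (hℓ : (n m₀).Prime) (htrans : ∀ a b : Fin (n m₀), ∃ π ∈ R, π m₀ a = b) (S : Finset (Fin r))
    (hex : ∃ π ∈ R, (∀ m ∈ S, π m = 1) ∧ π m₀ ≠ 1) :
    ∃ ρ ∈ R, (∀ m ∈ S, ρ m = 1) ∧ orderOf (ρ m₀) = n m₀ := by
  have h1 : (1 : PermsG n) ∈ R := one_mem_of_closed hmul hinv hne
  -- the slot image `G ≤ Sym(n m₀)`
  let G : Subgroup (Equiv.Perm (Fin (n m₀))) :=
    { carrier := {σ | ∃ π ∈ R, π m₀ = σ}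
      mul_mem' := fun {σ₁ σ₂} h₁ h₂ => by
        obtain ⟨π₁, hπ₁, rfl⟩ := h₁
        obtain ⟨π₂, hπ₂, rfl⟩ := h₂
        exact ⟨π₁ * π₂, hmul π₁ hπ₁ π₂ hπ₂, rfl⟩
      one_mem' := ⟨1, h1, rfl⟩
      inv_mem' := fun {σ} h => by
        obtain ⟨π, hπ, rfl⟩ := h
        exact ⟨π⁻¹, hinv π hπ, rfl⟩ }
  -- the image `N ≤ G` of the tuples trivial on `S`: a normal subgroup
  let N : Subgroup G :=
    { carrier := {g | ∃ π ∈ R, (∀ m ∈ S, π m = 1) ∧ π m₀ = (g : Equiv.Perm (Fin (n m₀)))}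
      mul_mem' := fun {g g'} h h' => by
        obtain ⟨π, hπ, hπS, hπg⟩ := h
        obtain ⟨π', hπ', hπ'S, hπ'g⟩ := h'
        refine ⟨π * π', hmul π hπ π' hπ', fun m hm => by rw [Pi.mul_apply, hπS m hm, hπ'S m hm, mul_one], ?_⟩
        rw [Pi.mul_apply, hπg, hπ'g]
        rfl
      one_mem' := ⟨1, h1, fun _ _ => rfl, rfl⟩
      inv_mem' := fun {g} h => by
        obtain ⟨π, hπ, hπS, hπg⟩ := h
        refine ⟨π⁻¹, hinv π hπ, fun m hm => by rw [Pi.inv_apply, hπS m hm, inv_one], ?_⟩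
        rw [Pi.inv_apply, hπg]
        rfl }
  haveI hN : N.Normal := ⟨fun g h g' => by
    obtain ⟨π, hπ, hπS, hπg⟩ := h
    obtain ⟨π', hπ', hπ'g⟩ := g'.2
    refine ⟨π' * π * π'⁻¹, hmul _ (hmul π' hπ' π hπ) _ (hinv π' hπ'), fun m hm => ?_, ?_⟩
    · rw [Pi.mul_apply, Pi.mul_apply, Pi.inv_apply, hπS m hm, mul_one, mul_inv_cancel]
    · rw [Pi.mul_apply, Pi.mul_apply, Pi.inv_apply, hπg, hπ'g]
      rfl⟩
  -- `G` is transitive of prime degree, hence primitive, hence quasi-primitive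
  haveI : MulAction.IsPretransitive G (Fin (n m₀)) := ⟨fun a b => by
    obtain ⟨π, hπ, hab⟩ := htrans a b
    exact ⟨⟨π m₀, π, hπ, rfl⟩, hab⟩⟩
  haveI : MulAction.IsPreprimitive G (Fin (n m₀)) :=
    MulAction.IsPreprimitive.of_prime_card (by rw [Nat.card_eq_fintype_card, Fintype.card_fin]; exact hℓ)
  -- `N` acts non-trivially, hence transitively
  obtain ⟨π₁, hπ₁, hπ₁S, hπ₁ne⟩ := hex
  have hfix : MulAction.fixedPoints N (Fin (n m₀)) ≠ Set.univ := by
    intro huniv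
    apply hπ₁ne
    ext a
    have ha : a ∈ MulAction.fixedPoints N (Fin (n m₀)) := by rw [huniv]; exact Set.mem_univ a
    rw [MulAction.mem_fixedPoints] at ha
    have h := ha ⟨⟨π₁ m₀, π₁, hπ₁, rfl⟩, π₁, hπ₁, hπ₁S, rfl⟩
    exact congrArg Fin.val h
  haveI : MulAction.IsPretransitive N (Fin (n m₀)) := MulAction.IsQuasiPreprimitive.isPretransitive_of_normal hfix
  -- Cauchy in `N`
  haveI : NeZero (n m₀) := ⟨hℓ.ne_zero⟩
  have hidx : (MulAction.stabilizer N (0 : Fin (n m₀))).index = n m₀ := by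
    rw [MulAction.index_stabilizer_of_transitive, Nat.card_eq_fintype_card, Fintype.card_fin]
  have hmulcard := (MulAction.stabilizer N (0 : Fin (n m₀))).index_mul_card
  have hdvd : n m₀ ∣ Nat.card N := ⟨Nat.card (MulAction.stabilizer N (0 : Fin (n m₀))), by rw [← hmulcard, hidx]⟩
  haveI : Fact (n m₀).Prime := ⟨hℓ⟩
  obtain ⟨σ, hσ⟩ := exists_prime_orderOf_dvd_card' (n m₀) hdvd
  obtain ⟨π, hπ, hπS, hπσ⟩ := σ.2
  refine ⟨π, hπ, hπS, ?_⟩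
  rw [hπσ, Subgroup.orderOf_coe, Subgroup.orderOf_coe]
  exact hσ

/-- **… then also one that is moreover the identity on any set `M` of slots whose component orders are prime to `ℓ`** (the power trick `exists_pow_pure_on` on top
of `exists_orderOf_eq_of_trivial_on`; the identity components on `S` stay identity under powers). [cite: DixonMortimer1996, §1.6] -/
theorem exists_orderOf_eq_of_trivial_on_of_lt (hmul : ∀ π ∈ R, ∀ π' ∈ R, π * π' ∈ R) (hinv : ∀ π ∈ R, π⁻¹ ∈ R) (hne : R.Nonempty)
    {m₀ : Fin r} (hℓ : (n m₀).Prime) (htrans : ∀ a b : Fin (n m₀), ∃ π ∈ R, π m₀ a = b) (S M : Finset (Fin r))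
    (hM : ∀ m ∈ M, n m < n m₀) (hex : ∃ π ∈ R, (∀ m ∈ S, π m = 1) ∧ π m₀ ≠ 1) :
    ∃ ρ ∈ R, (∀ m ∈ S, ρ m = 1) ∧ (∀ m ∈ M, ρ m = 1) ∧ orderOf (ρ m₀) = n m₀ := by
  obtain ⟨π, hπ, hπS, hord⟩ := exists_orderOf_eq_of_trivial_on hmul hinv hne hℓ htrans S hex
  have hcop : ∀ m ∈ M, (orderOf (π m₀)).Coprime (orderOf (π m)) := fun m hm => by
    rw [hord]
    exact coprime_orderOf_of_lt hℓ (hM m hm) (π m)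
  obtain ⟨N, hN₀, hN⟩ := exists_pow_pure_on π m₀ M hcop
  refine ⟨π ^ N, ?_, fun m hm => by rw [Pi.pow_apply, hπS m hm, one_pow], hN, by rw [hN₀, hord]⟩
  cases N with
  | zero => rw [pow_zero]; exact one_mem_of_closed hmul hinv hne
  | succ N =>
    clear hN₀ hN
    induction N with
    | zero => rw [zero_add, pow_one]; exact hπ
    | succ N ih => rw [pow_succ]; exact hmul _ ih _ hπ

end Group

/-! ## §2 Realised: an automorphism of `ℂ` over `k` fixing the predecessors and moving the slot -/

section Realised

variable {I : Type} {r : ℕ} {Kf : I → Type} [∀ i, Field (Kf i)] [∀ i, NumberField (Kf i)] {i₀ : I} {is : Fin r → I} {n : Fin r → ℕ}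
  {e : ∀ m : Fin r, (Kf (is m) →+* ℂ) ≃ Fin (n m) × Bool} {τ : Kf i₀ →+* ℂ} {im : ∀ m : Fin r, Kf i₀ →+* Kf (is m)}
  (he_sign : ∀ (m : Fin r) (s : Kf (is m) →+* ℂ), (e m s).2 = true ↔ s.comp (im m) = τ)

omit [∀ i, NumberField (Kf i)] in
include he_sign in
/-- **An automorphism of `ℂ` over `τ(k)` that FIXES every `τ`-embedding of the fields of `S` and MOVES some `τ`-embedding of `K_{m₀}` realises a tuple that is the
identity on `S` and not at `m₀`.** [cite: Shimura1998, §18.2 Lemma (i)] -/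
theorem exists_trivial_on_ne_one_mem_realisedTuples (S : Finset (Fin r)) (m₀ : Fin r) (ρ : ℂ ≃+* ℂ) (hρ : (ρ : ℂ →+* ℂ).comp τ = τ)
    (hfix : ∀ m ∈ S, ∀ s : Kf (is m) →+* ℂ, s.comp (im m) = τ → (ρ : ℂ →+* ℂ).comp s = s)
    (hmove : ∃ s : Kf (is m₀) →+* ℂ, s.comp (im m₀) = τ ∧ (ρ : ℂ →+* ℂ).comp s ≠ s) :
    ∃ π ∈ realisedTuples e τ, (∀ m ∈ S, π m = 1) ∧ π m₀ ≠ 1 := by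
  obtain ⟨π, hπ, hπρ⟩ := exists_mem_realisedTuples_of_comp_tau_eq (e := e) he_sign ρ hρ
  refine ⟨π, hπ, fun m hm => ?_, ?_⟩
  · ext a
    have hs : ((e m).symm (a, true)).comp (im m) = τ := (he_sign m _).1 (by rw [Equiv.apply_symm_apply])
    have h := hπρ m a
    rw [hfix m hm _ hs] at h
    exact congrArg Fin.val ((Prod.mk.inj ((e m).symm.injective h)).1).symm
  · obtain ⟨s, hsτ, hs⟩ := hmove
    intro h1
    apply hs
    have hs' : (e m₀).symm ((e m₀ s).1, true) = s := by
      rw [show ((e m₀ s).1, true) = e m₀ s from Prod.ext rfl ((he_sign m₀ s).2 hsτ).symm, Equiv.symm_apply_apply]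
    have h := hπρ m₀ (e m₀ s).1
    rw [hs', h1, Equiv.Perm.one_apply, hs'] at h
    exact h

include he_sign in
/-- **THE PURE ROTATIONS OF AN ORDERED PRIME TOWER, realised.**  Tower slots (outside `L`) have PRIME sizes, each larger than every slot of `L`, and a priority `prio`
refining the sizes; if each tower slot `m₀` having an equal-size predecessor is MOVED by an automorphism of `ℂ` over `τ(k)` FIXING every `τ`-embedding of its
equal-size predecessors (`hH`), then for every tower slot some realised tuple is the identity on `L` and on all tower slots of lower priority, with `m₀`-component
of order `n m₀` — the `hpure` input of `const_of_signed_primeTower`.  (No predecessor of equal size: Cauchy + power trick as in `pure_realisedTuples_primeTower`.)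
[cite: DixonMortimer1996, §1.6 and Thm. 1.6A] [cite: Shimura1998, §18.2 Lemma (i)] -/
theorem pure_realisedTuples_orderedPrimeTower (L : Finset (Fin r)) (prio : Fin r → ℕ) (hpr : ∀ m, m ∉ L → (n m).Prime)
    (hLt : ∀ m ∈ L, ∀ m', m' ∉ L → n m < n m') (hmono : ∀ m m', m ∉ L → m' ∉ L → n m < n m' → prio m < prio m')
    (hH : ∀ m₀, m₀ ∉ L → (∃ m, m ∉ L ∧ m ≠ m₀ ∧ n m = n m₀ ∧ prio m < prio m₀) →
      ∃ ρ : ℂ ≃+* ℂ, (ρ : ℂ →+* ℂ).comp τ = τ ∧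
        (∀ m, m ∉ L → n m = n m₀ → prio m < prio m₀ → ∀ s : Kf (is m) →+* ℂ, s.comp (im m) = τ → (ρ : ℂ →+* ℂ).comp s = s) ∧
        ∃ s : Kf (is m₀) →+* ℂ, s.comp (im m₀) = τ ∧ (ρ : ℂ →+* ℂ).comp s ≠ s) :
    ∀ m₀, m₀ ∉ L → ∃ ρ ∈ realisedTuples e τ, (∀ m ∈ L, ρ m = 1) ∧ (∀ m, m ∉ L → prio m < prio m₀ → ρ m = 1) ∧ orderOf (ρ m₀) = n m₀ := by
  intro m₀ hm₀
  have hmul : ∀ π ∈ realisedTuples e τ, ∀ π' ∈ realisedTuples e τ, π * π' ∈ realisedTuples e τ :=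
    fun π hπ π' hπ' => mul_mem_realisedTuples e τ hπ hπ'
  have hinv : ∀ π ∈ realisedTuples e τ, π⁻¹ ∈ realisedTuples e τ := fun π hπ => inv_mem_realisedTuples hπ
  have hne : (realisedTuples e τ).Nonempty := realisedTuples_nonempty (e := e) he_sign
  -- the equal-size predecessors `S` and the smaller slots `M`
  set S : Finset (Fin r) := univ.filter fun m => m ∉ L ∧ m ≠ m₀ ∧ n m = n m₀ ∧ prio m < prio m₀ with hS
  set M : Finset (Fin r) := univ.filter fun m => n m < n m₀ with hM
  have hMlt : ∀ m ∈ M, n m < n m₀ := fun m hm => by rw [hM] at hm; exact (Finset.mem_filter.1 hm).2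
  -- a realised tuple trivial on `S` and on `M`, of order `n m₀` at `m₀`
  have key : ∃ ρ ∈ realisedTuples e τ, (∀ m ∈ S, ρ m = 1) ∧ (∀ m ∈ M, ρ m = 1) ∧ orderOf (ρ m₀) = n m₀ := by
    by_cases hSe : S = ∅
    · obtain ⟨ρ, hρ, hρM, hord⟩ := exists_pure_on_mem_realisedTuples (e := e) he_sign m₀ (hpr m₀ hm₀) M hMlt
      exact ⟨ρ, hρ, fun m hm => absurd hm (by rw [hSe]; exact Finset.notMem_empty m), hρM, hord⟩
    · obtain ⟨m₁, hm₁⟩ := Finset.nonempty_iff_ne_empty.2 hSe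
      rw [hS] at hm₁
      obtain ⟨-, hm₁L, hm₁ne, hm₁n, hm₁p⟩ := Finset.mem_filter.1 hm₁
      obtain ⟨ρ₀, hρ₀τ, hρ₀fix, hρ₀move⟩ := hH m₀ hm₀ ⟨m₁, hm₁L, hm₁ne, hm₁n, hm₁p⟩
      have hex := exists_trivial_on_ne_one_mem_realisedTuples (e := e) he_sign S m₀ ρ₀ hρ₀τ
        (fun m hm => by
          rw [hS] at hm
          obtain ⟨-, hmL, -, hmn, hmp⟩ := Finset.mem_filter.1 hm
          exact hρ₀fix m hmL hmn hmp) hρ₀move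
      exact exists_orderOf_eq_of_trivial_on_of_lt hmul hinv hne (hpr m₀ hm₀) (fun a b => transitive_realisedTuples (e := e) he_sign m₀ a b) S M hMlt hex
  obtain ⟨ρ, hρ, hρS, hρM, hord⟩ := key
  refine ⟨ρ, hρ, fun m hm => hρM m (by rw [hM]; exact Finset.mem_filter.2 ⟨Finset.mem_univ _, hLt m hm m₀ hm₀⟩), fun m hmL hmp => ?_, hord⟩
  -- a tower slot of lower priority is smaller or of equal size
  by_cases hlt : n m < n m₀
  · exact hρM m (by rw [hM]; exact Finset.mem_filter.2 ⟨Finset.mem_univ _, hlt⟩)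
  · have hmm₀ : m ≠ m₀ := fun h => by rw [h] at hmp; exact lt_irrefl _ hmp
    have hge : ¬ n m₀ < n m := fun h => lt_asymm hmp (hmono m₀ m hm₀ hmL h)
    have heq : n m = n m₀ := by omega
    exact hρS m (by rw [hS]; exact Finset.mem_filter.2 ⟨Finset.mem_univ _, hmL, hmm₀, heq, hmp⟩)

/-! ## §3 The defect law for an ordered prime tower over coprime one-member slots -/

include he_sign in
/-- **THE DEFECT LAW — ORDERED PRIME TOWER (equal primes allowed) OVER ONE-MEMBER SLOTS OF PAIRWISE COPRIME SIZES.**  `L`: one-member position sets, pairwise coprime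
sizes; outside `L`: PRIME sizes larger than those of `L`, proper non-empty position sets, a priority `prio` injective on the tower and refining the sizes, and the
automorphism hypothesis `hH` for the slots with an equal-size predecessor.  Every configuration balanced under the realised tuples obeys the defect law with any
`c m = n m − 2|P m|` (as integers).  NO other hypothesis on the fields. [cite: MoonenZarhin1995Duke, Thm. 2.4] [cite: DixonMortimer1996, §1.6 and Thm. 1.6A] -/
theorem exists_hasDefectsG_realisedTuples_of_orderedPrimeTower_oneMember (L : Finset (Fin r)) (prio : Fin r → ℕ)
    (hpr : ∀ m, m ∉ L → (n m).Prime) (hinj : ∀ m m', m ∉ L → m' ∉ L → prio m = prio m' → m = m')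
    (hmono : ∀ m m', m ∉ L → m' ∉ L → n m < n m' → prio m < prio m') (hLt : ∀ m ∈ L, ∀ m', m' ∉ L → n m < n m')
    (hcop : ∀ m ∈ L, ∀ m' ∈ L, m ≠ m' → (n m).Coprime (n m'))
    (hH : ∀ m₀, m₀ ∉ L → (∃ m, m ∉ L ∧ m ≠ m₀ ∧ n m = n m₀ ∧ prio m < prio m₀) →
      ∃ ρ : ℂ ≃+* ℂ, (ρ : ℂ →+* ℂ).comp τ = τ ∧
        (∀ m, m ∉ L → n m = n m₀ → prio m < prio m₀ → ∀ s : Kf (is m) →+* ℂ, s.comp (im m) = τ → (ρ : ℂ →+* ℂ).comp s = s) ∧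
        ∃ s : Kf (is m₀) →+* ℂ, s.comp (im m₀) = τ ∧ (ρ : ℂ →+* ℂ).comp s ≠ s)
    {P : ∀ m : Fin r, Finset (Fin (n m))} (hP1 : ∀ m ∈ L, ∃ p : Fin (n m), P m = {p})
    (hP0 : ∀ m, m ∉ L → (P m).Nonempty) (hPn : ∀ m, m ∉ L → (P m).card < n m)
    (c : Fin r → ℕ) (hc : ∀ m, ((c m : ℕ) : ℤ) = (n m : ℤ) - 2 * (P m).card)
    {α : Type} (v : α → PtG n) (T : Finset α) (hT : ModelBalancedG P (realisedTuples e τ) v T) :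
    ∃ t : Fin r → ℤ, HasDefectsG c v T t := by
  have hmul : ∀ π ∈ realisedTuples e τ, ∀ π' ∈ realisedTuples e τ, π * π' ∈ realisedTuples e τ :=
    fun π hπ π' hπ' => mul_mem_realisedTuples e τ hπ hπ'
  have hinv : ∀ π ∈ realisedTuples e τ, π⁻¹ ∈ realisedTuples e τ := fun π hπ => inv_mem_realisedTuples hπ
  have hne : (realisedTuples e τ).Nonempty := realisedTuples_nonempty (e := e) he_sign
  have htrans : ∀ (m : Fin r) (a b : Fin (n m)), ∃ π ∈ realisedTuples e τ, π m a = b := fun m a b =>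
    transitive_realisedTuples (e := e) he_sign m a b
  have hconst := const_of_signed_primeTower_coprime (P := P) hmul hinv hne L prio hpr hinj hP0 hPn
    (pure_realisedTuples_orderedPrimeTower (e := e) he_sign L prio hpr hLt hmono hH)
    (fun m hm m' hm' hmm' => by
      obtain ⟨p, hp⟩ := hP1 m hm
      obtain ⟨p', hp'⟩ := hP1 m' hm'
      rw [card_orbitG_singleton hp (htrans m), card_orbitG_singleton hp' (htrans m')]
      exact hcop m hm m' hm' hmm')
    (fun m hm f hf => by
      obtain ⟨p, hp⟩ := hP1 m hm
      exact sep_of_singletons (fun a => singleton_mem_orbitG hp (htrans m) a) f hf)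
    fun π hπ => signed_of_modelBalancedG (realisedTuples e τ) v hT hπ
  obtain ⟨t, hd, he⟩ := exists_defects_of_const (P := P) hne hconst fun π hπ => signed_of_modelBalancedG (realisedTuples e τ) v hT hπ
  refine ⟨t, fun m a => hd m a, ?_⟩
  rw [he]
  exact Finset.sum_congr rfl fun m _ => by rw [hc m]

end Realised

/-! ## §4 The headline -/

section Headline

variable {I : Type} {r : ℕ} {Kf : I → Type} [∀ i, Field (Kf i)] [∀ i, NumberField (Kf i)] [∀ i, IsCMField (Kf i)]
  {i₀ : I} {is : Fin r → I} {n : Fin r → ℕ} {τ : Kf i₀ →+* ℂ}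
  {A : Fin (r + 1) → AbelianVariety ℂ} {Φ : ∀ j : Fin (r + 1), CMType (Kf (mfSlots i₀ is j))}
  {ι : ∀ j, 𝓞 (Kf (mfSlots i₀ is j)) →+* End (A j)}
  {θ : ∀ j, Kf (mfSlots i₀ is j) →+* Module.End ℂ (complexBetti (A j).X 1)}

/-- **HEADLINE — AN ORDERED TOWER OF PRIME RELATIVE DEGREES (repetitions allowed) WITH ANY TYPES, OVER ONE-MEMBER FIELDS OF PAIRWISE COPRIME RELATIVE DEGREES.**
`k = Kf i₀` imaginary quadratic, `E = A 0 ⊨ (k; {τ})` (`τ(δ) = i√d`), `B_m = A (m+1) ⊨ (K_m; Φ (m+1))` over CM fields `K_m ⊇ i_m(k)`, `n_m = [K_m : k]`, types read by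
frames `e m` at position sets `P m` of sizes `p_m` (`0 < p_m`, `2p_m ≤ n_m`).  Slots of `L`: `p_m = 1`, `n_m` pairwise coprime.  Slots outside `L`: `n_m` PRIME and
larger than the `n_{m'}` (`m' ∈ L`), with a priority `prio` (injective on them, refining the sizes) such that every such slot having an equal-degree predecessor is
MOVED by an automorphism of `ℂ` over `τ(k)` FIXING all `τ`-embeddings of its equal-degree predecessors (`hH` — e.g. two fields of the same prime relative degree,
the later one not contained in the Galois closure of the earlier one over `k`).  Then the Hodge conjecture holds for EVERY product of copies `⨁_j A(κ j)` GIVEN the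
single-slot Weil spaces `hW m`.  Pairwise distinct primes (`hH` vacuous) is `hodgeConjectureFor_biproduct_comp_of_primeTower_oneMember`.  `HC_CM` is NOT asserted.
[cite: Pohlmann1968, Thm 1] [cite: Milne2020HodgeClassesAV, 1.2 (a) and Thm. 1] [cite: MoonenZarhin1995Duke, Thm. 2.4] [cite: DixonMortimer1996, §1.6 and Thm. 1.6A] -/
theorem hodgeConjectureFor_biproduct_comp_of_orderedPrimeTower_oneMember (P : ∀ m : Fin r, Finset (Fin (n m))) (p : Fin r → ℕ)
    (hcard : ∀ m, (P m).card = p m) (L : Finset (Fin r)) (prio : Fin r → ℕ)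
    (hpr : ∀ m, m ∉ L → (n m).Prime) (hinj : ∀ m m', m ∉ L → m' ∉ L → prio m = prio m' → m = m')
    (hmono : ∀ m m', m ∉ L → m' ∉ L → n m < n m' → prio m < prio m') (hLt : ∀ m ∈ L, ∀ m', m' ∉ L → n m < n m')
    (hcop : ∀ m ∈ L, ∀ m' ∈ L, m ≠ m' → (n m).Coprime (n m'))
    (hp1 : ∀ m ∈ L, p m = 1) (hp0 : ∀ m, 0 < p m) (hpn : ∀ m, 2 * p m ≤ n m)
    {N : ℕ} (κ : Fin N → Fin (r + 1)) (h2 : Module.finrank ℚ (Kf i₀) = 2) (im : ∀ m : Fin r, Kf i₀ →+* Kf (is m))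
    (hH : ∀ m₀, m₀ ∉ L → (∃ m, m ∉ L ∧ m ≠ m₀ ∧ n m = n m₀ ∧ prio m < prio m₀) →
      ∃ ρ : ℂ ≃+* ℂ, (ρ : ℂ →+* ℂ).comp τ = τ ∧
        (∀ m, m ∉ L → n m = n m₀ → prio m < prio m₀ → ∀ s : Kf (is m) →+* ℂ, s.comp (im m) = τ → (ρ : ℂ →+* ℂ).comp s = s) ∧
        ∃ s : Kf (is m₀) →+* ℂ, s.comp (im m₀) = τ ∧ (ρ : ℂ →+* ℂ).comp s ≠ s)
    {δ : 𝓞 (Kf i₀)} {d : ℕ} (hτ : τ (δ : Kf i₀) = Complex.I * (Real.sqrt d : ℂ))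
    (hA : ∀ j, IsCMTypeRealisation (Φ j) (A j) (ι j) (θ j))
    (e : ∀ m : Fin r, (Kf (is m) →+* ℂ) ≃ Fin (n m) × Bool)
    (he_sign : ∀ (m : Fin r) (s : Kf (is m) →+* ℂ), (e m s).2 = true ↔ s.comp (im m) = τ)
    (he_conj : ∀ (m : Fin r) (s : Kf (is m) →+* ℂ), e m (ComplexEmbedding.conjugate s) = ((e m s).1, !(e m s).2))
    (hΨ : ∀ σ : Kf i₀ →+* ℂ, σ ∈ (Φ 0).1 ↔ σ = τ)
    (hΦ : ∀ (m : Fin r) (s : Kf (is m) →+* ℂ), s ∈ (Φ m.succ).1 ↔ (e m s).2 = decide ((e m s).1 ∈ P m))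
    (hW : ∀ m : Fin r, weilClassesOf (⨁ fun i => A (partSlots (n m - 2 * p m) m i))
      (biproduct.map fun i => ι (partSlots (n m - 2 * p m) m i) (δfam im δ (partSlots (n m - 2 * p m) m i))) (n m - p m) d ≤
      algebraicClasses (⨁ fun i => A (partSlots (n m - 2 * p m) m i)).X (n m - p m)) :
    HodgeConjectureFor (⨁ fun j => A (κ j)).dim (⨁ fun j => A (κ j)).X :=
  hodgeConjectureFor_biproduct_comp_of_defectLawG (is := is) P (fun m => n m - 2 * p m) (fun m => n m - p m)
    (fun m => by have := hpn m; omega) (fun m => by have := hp0 m; have := hpn m; omega) κ h2 im hτ hA e he_sign he_conj hΨ hΦ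
    (fun v T hT => exists_hasDefectsG_realisedTuples_of_orderedPrimeTower_oneMember (e := e) he_sign L prio hpr hinj hmono hLt hcop hH
      (fun m hm => Finset.card_eq_one.1 (by rw [hcard m, hp1 m hm]))
      (fun m _ => Finset.card_pos.1 (by rw [hcard m]; exact hp0 m)) (fun m _ => by have := hpn m; have := hp0 m; rw [hcard m]; omega)
      (fun m => n m - 2 * p m) (cast_sub_two_mul_eq hcard hpn) v T hT) hW

/-- **… and for every abelian variety DOMINATED by such a product.** `HC_CM` is NOT asserted. [cite: MumfordAV1970, §19] [cite: Pohlmann1968, Thm 1] -/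
theorem hodgeConjectureFor_of_avDominatedBy_comp_of_orderedPrimeTower_oneMember (P : ∀ m : Fin r, Finset (Fin (n m))) (p : Fin r → ℕ)
    (hcard : ∀ m, (P m).card = p m) (L : Finset (Fin r)) (prio : Fin r → ℕ)
    (hpr : ∀ m, m ∉ L → (n m).Prime) (hinj : ∀ m m', m ∉ L → m' ∉ L → prio m = prio m' → m = m')
    (hmono : ∀ m m', m ∉ L → m' ∉ L → n m < n m' → prio m < prio m') (hLt : ∀ m ∈ L, ∀ m', m' ∉ L → n m < n m')
    (hcop : ∀ m ∈ L, ∀ m' ∈ L, m ≠ m' → (n m).Coprime (n m'))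
    (hp1 : ∀ m ∈ L, p m = 1) (hp0 : ∀ m, 0 < p m) (hpn : ∀ m, 2 * p m ≤ n m)
    {N : ℕ} (κ : Fin N → Fin (r + 1)) (h2 : Module.finrank ℚ (Kf i₀) = 2) (im : ∀ m : Fin r, Kf i₀ →+* Kf (is m))
    (hH : ∀ m₀, m₀ ∉ L → (∃ m, m ∉ L ∧ m ≠ m₀ ∧ n m = n m₀ ∧ prio m < prio m₀) →
      ∃ ρ : ℂ ≃+* ℂ, (ρ : ℂ →+* ℂ).comp τ = τ ∧
        (∀ m, m ∉ L → n m = n m₀ → prio m < prio m₀ → ∀ s : Kf (is m) →+* ℂ, s.comp (im m) = τ → (ρ : ℂ →+* ℂ).comp s = s) ∧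
        ∃ s : Kf (is m₀) →+* ℂ, s.comp (im m₀) = τ ∧ (ρ : ℂ →+* ℂ).comp s ≠ s)
    {δ : 𝓞 (Kf i₀)} {d : ℕ} (hτ : τ (δ : Kf i₀) = Complex.I * (Real.sqrt d : ℂ))
    (hA : ∀ j, IsCMTypeRealisation (Φ j) (A j) (ι j) (θ j))
    (e : ∀ m : Fin r, (Kf (is m) →+* ℂ) ≃ Fin (n m) × Bool)
    (he_sign : ∀ (m : Fin r) (s : Kf (is m) →+* ℂ), (e m s).2 = true ↔ s.comp (im m) = τ)
    (he_conj : ∀ (m : Fin r) (s : Kf (is m) →+* ℂ), e m (ComplexEmbedding.conjugate s) = ((e m s).1, !(e m s).2))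
    (hΨ : ∀ σ : Kf i₀ →+* ℂ, σ ∈ (Φ 0).1 ↔ σ = τ)
    (hΦ : ∀ (m : Fin r) (s : Kf (is m) →+* ℂ), s ∈ (Φ m.succ).1 ↔ (e m s).2 = decide ((e m s).1 ∈ P m))
    (hW : ∀ m : Fin r, weilClassesOf (⨁ fun i => A (partSlots (n m - 2 * p m) m i))
      (biproduct.map fun i => ι (partSlots (n m - 2 * p m) m i) (δfam im δ (partSlots (n m - 2 * p m) m i))) (n m - p m) d ≤
      algebraicClasses (⨁ fun i => A (partSlots (n m - 2 * p m) m i)).X (n m - p m))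
    {X : AbelianVariety ℂ} (hX : Domination.AVDominatedBy X (⨁ fun j => A (κ j))) : HodgeConjectureFor X.dim X.X :=
  Domination.hodgeConjectureFor_of_avDominatedBy
    (hodgeConjectureFor_biproduct_comp_of_orderedPrimeTower_oneMember P p hcard L prio hpr hinj hmono hLt hcop hp1 hp0 hpn κ h2 im hH hτ hA e
      he_sign he_conj hΨ hΦ hW) hX

/-- **INTRINSIC FORM (no frames)**: only `[K_m : ℚ] = 2 n_m`, the `k`-signatures `p_m`, the order `prio` and the automorphism hypothesis `hH`.  `HC_CM` is NOT asserted.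
[cite: Pohlmann1968, Thm 1] [cite: Milne2020HodgeClassesAV, 1.2 (a) and Thm. 1] [cite: MoonenZarhin1995Duke, Thm. 2.4] [cite: Shimura1998, §18.2 Lemma (i)] -/
theorem hodgeConjectureFor_biproduct_comp_of_orderedPrimeTower_oneMember_intrinsic (p : Fin r → ℕ) (L : Finset (Fin r)) (prio : Fin r → ℕ)
    (hpr : ∀ m, m ∉ L → (n m).Prime) (hinj : ∀ m m', m ∉ L → m' ∉ L → prio m = prio m' → m = m')
    (hmono : ∀ m m', m ∉ L → m' ∉ L → n m < n m' → prio m < prio m') (hLt : ∀ m ∈ L, ∀ m', m' ∉ L → n m < n m')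
    (hcop : ∀ m ∈ L, ∀ m' ∈ L, m ≠ m' → (n m).Coprime (n m'))
    (hp1 : ∀ m ∈ L, p m = 1) (hp0 : ∀ m, 0 < p m) (hpn : ∀ m, 2 * p m ≤ n m)
    {N : ℕ} (κ : Fin N → Fin (r + 1)) (h2 : Module.finrank ℚ (Kf i₀) = 2) (hdeg : ∀ m : Fin r, Module.finrank ℚ (Kf (is m)) = 2 * n m)
    (im : ∀ m : Fin r, Kf i₀ →+* Kf (is m))
    (hH : ∀ m₀, m₀ ∉ L → (∃ m, m ∉ L ∧ m ≠ m₀ ∧ n m = n m₀ ∧ prio m < prio m₀) →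
      ∃ ρ : ℂ ≃+* ℂ, (ρ : ℂ →+* ℂ).comp τ = τ ∧
        (∀ m, m ∉ L → n m = n m₀ → prio m < prio m₀ → ∀ s : Kf (is m) →+* ℂ, s.comp (im m) = τ → (ρ : ℂ →+* ℂ).comp s = s) ∧
        ∃ s : Kf (is m₀) →+* ℂ, s.comp (im m₀) = τ ∧ (ρ : ℂ →+* ℂ).comp s ≠ s)
    {δ : 𝓞 (Kf i₀)} {d : ℕ} (hτ : τ (δ : Kf i₀) = Complex.I * (Real.sqrt d : ℂ))
    (hA : ∀ j, IsCMTypeRealisation (Φ j) (A j) (ι j) (θ j))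
    (hΨ : ∀ σ : Kf i₀ →+* ℂ, σ ∈ (Φ 0).1 ↔ σ = τ)
    (hp : ∀ m : Fin r, (Finset.univ.filter fun s : Kf (is m) →+* ℂ => s.comp (im m) = τ ∧ s ∈ (Φ m.succ).1).card = p m)
    (hW : ∀ m : Fin r, weilClassesOf (⨁ fun i => A (partSlots (n m - 2 * p m) m i))
      (biproduct.map fun i => ι (partSlots (n m - 2 * p m) m i) (δfam im δ (partSlots (n m - 2 * p m) m i))) (n m - p m) d ≤
      algebraicClasses (⨁ fun i => A (partSlots (n m - 2 * p m) m i)).X (n m - p m)) :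
    HodgeConjectureFor (⨁ fun j => A (κ j)).dim (⨁ fun j => A (κ j)).X := by
  have hττ : ComplexEmbedding.conjugate τ ≠ τ := QuarticCM.conjugate_ne τ
  have hk : ∀ σ : Kf i₀ →+* ℂ, σ = τ ∨ σ = ComplexEmbedding.conjugate τ := fun σ => QuarticCM.eq_or_eq_conjugate_of_quadratic h2 τ σ
  have hfr : ∀ m : Fin r, ∃ e : (Kf (is m) →+* ℂ) ≃ Fin (n m) × Bool, (∀ s, (e s).2 = true ↔ s.comp (im m) = τ) ∧
      ∀ s, e (ComplexEmbedding.conjugate s) = ((e s).1, !(e s).2) := fun m => exists_signFrame (hdeg m) h2 (im m) hττ hk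
  choose e he_sign he_conj using hfr
  exact hodgeConjectureFor_biproduct_comp_of_orderedPrimeTower_oneMember
    (fun m => Finset.univ.filter fun a : Fin (n m) => (e m).symm (a, true) ∈ (Φ m.succ).1) p
    (fun m => (card_posSet (he_sign m) (Φ m.succ)).trans (hp m)) L prio hpr hinj hmono hLt hcop hp1 hp0 hpn κ h2 im hH hτ hA e he_sign he_conj hΨ
    (fun m s => mem_iff_snd_eq_decide_mem_posSet (he_conj m) (Φ m.succ) s) hW

end Headline

end Summit.HodgeConjecture.CorCM.MultiFieldWeil

end
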